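import Mathlib
import HarnessLib
import Summits.NavierStokesRegularity.NavierStokesRegularity.Theorems.UnthreadedRigidityDoorUnthreadedRigidityThreadingJetsWindowDegreeOne
import Summits.NavierStokesRegularity.NavierStokesRegularity.Theorems.UnthreadedRigidityDoorUnthreadedRigidityVirialHornBracketThree

/-!
# THREADING JETS, THE WINDOW RUNG IN DEGREES TWO AND THREE, UNCONDITIONALLY: `IsotypicWindowRigidityL 2 n`, `IsotypicWindowRigidityL 3 n`

W2 ⟨stmt-NavierStokesRegularity-27585⟩ `UnthreadedRigidity`, line g11-1 (VIRIAL HORN), KEY-NS #210 (W-i) / dss_155 / DIRECTOR-NS #299.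

Pure compositions: ns-crc-p1's per-degree window rung `isotypicWindowRigidityL_of_bracketInjective_at` (p715311: bridge W at degree `l` from
bracket injectivity at degree `l`, W₂, V-W `virialWindowSilence_holds`, S-C `angularLemma_holds`, S-A/S-V/S-Z/S-U) fed with the kernel-checked
bracket injectivity of ns-crc-p2 g9 in degrees two and three (`VirialHorn.bracketInjective_two`, file `…VirialHornBracketTwo`;
`VirialHorn.bracketInjective_three`, file `…VirialHornBracketThree`):

* ★ `isotypicWindowRigidity_two_holds (n) : IsotypicWindowRigidityL 2 n` — every unthreaded window (hypotheses of `UnthreadedRigidity` VERBATIM)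
  all of whose slices are admissible DEGREE-TWO isotypic poloidal data about `x₀` (quadrupole stream functions `Σ_m c_m(|y|,t) B_m(y)` over a fixed
  linearly independent family of trace-free quadratic forms) is axisymmetric about one common axis through `x₀`;
* ★ `isotypicWindowRigidity_three_holds (n) : IsotypicWindowRigidityL 3 n` — the same in DEGREE THREE (octupole stream functions);
* `isotypicWindowRigidity_of_le_three` — degrees `1 ≤ l ≤ 3` together (degree one is ns-crc-p1's `isotypicWindowRigidity_one_holds`).

HONEST LABEL: isotypic windows of one fixed degree are SPECIAL data (general unthreaded windows superpose degrees — the line's own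
«why it might fail»); ⟨27585⟩ `UnthreadedRigidity`, W2 and NS regularity stay OPEN; MODEL rung — no NS regularity statement is proved here.
`--supports stmt-NavierStokesRegularity-27585` (helper); ns-crc-p2 g9; 0 kit.  [folklore]
-/

noncomputable section

-- the summit and its single sub-problem share the name (CONVENTIONS §1), as in every Theorems file
set_option linter.dupNamespace false

namespace Summit.NavierStokesRegularity.NavierStokesRegularity.Theorems.UnthreadedRigidity.ThreadingJets

open Summit.NavierStokesRegularity.NavierStokesRegularity.Theorems.UnthreadedRigidity.VirialHorn
  (IsotypicWindowRigidityL bracketInjective_two bracketInjective_three)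

/-- ★ **THE WINDOW RUNG IN DEGREE TWO, UNCONDITIONALLY**: `IsotypicWindowRigidityL 2 n` for every `n` (per-degree rung of p715311 +
`bracketInjective_two`). -/
theorem isotypicWindowRigidity_two_holds (n : ℕ) : IsotypicWindowRigidityL 2 n :=
  isotypicWindowRigidityL_of_bracketInjective_at 2 (fun n B hB2 hB w hw => bracketInjective_two n B hB2 hB w hw) n (by norm_num)

/-- ★ **THE WINDOW RUNG IN DEGREE THREE, UNCONDITIONALLY**: `IsotypicWindowRigidityL 3 n` for every `n` (per-degree rung of p715311 +
`bracketInjective_three`). -/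
theorem isotypicWindowRigidity_three_holds (n : ℕ) : IsotypicWindowRigidityL 3 n :=
  isotypicWindowRigidityL_of_bracketInjective_at 3 (fun n B hB3 hB w hw => bracketInjective_three n B hB3 hB w hw) n (by norm_num)

/-- THE WINDOW RUNG IN ALL DEGREES `1 ≤ l ≤ 3`, unconditionally (degree one: ns-crc-p1's `isotypicWindowRigidity_one_holds`). -/
theorem isotypicWindowRigidity_of_le_three (l n : ℕ) (h1 : 1 ≤ l) (h3 : l ≤ 3) : IsotypicWindowRigidityL l n := by
  interval_cases l
  · exact isotypicWindowRigidity_one_holds n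
  · exact isotypicWindowRigidity_two_holds n
  · exact isotypicWindowRigidity_three_holds n

end Summit.NavierStokesRegularity.NavierStokesRegularity.Theorems.UnthreadedRigidity.ThreadingJets

end
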